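import Mathlib.FieldTheory.RatFunc.AsPolynomial
import Mathlib.FieldTheory.IsAlgClosed.Basic
import Mathlib.RingTheory.Algebraic.Integral
import Mathlib.Algebra.Polynomial.Lifts
import Mathlib.Algebra.Order.Group.Finset
import Literature.IUT.HodgeTheaters.KappaCoricFunctions
import HarnessLib

/-!
# [IUTchI] Remark 3.1.7 (ii): existence of `κ`-coric functions of degree `4`; every value is attained
# — PROOFS under the standing hypotheses of the Remark

S. Mochizuki, *Inter-universal Teichmüller theory I*, §3, Remark 3.1.7 (ii) (kurims final
manuscript May 2020, p. 67) [claim: Mochizuki2012, status: disputed]. PROOF-ONLY companion of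
`Literature/IUT/HodgeTheaters/KappaCoricFunctions.lean` (statement module, abc-iut-L5-t2); no new
definitions.

The two existence claims typed there, `CriticalLocus.ExistsKappaCoricDegreeFour` ("there exists a
`κ`-coric `f_sol ∈ L_C` of degree `4`", "it follows immediately from the elementary theory of
polynomial functions on the affine line") and `CriticalLocus.EveryValueAttained` ("every element of
`L̄` appears as a value of some `κ`-coric rational function on `C_L` at some `L̄`-valued point of
`C_L` that is not critical"), are parametrised by an ARBITRARY field `Ω` and an ARBITRARY
`3`-element `CriticalLocus`. In print `Ω = L̄` is an algebraic closure and the strictly critical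
points are the images of the `2`-torsion points of `E_F`, hence ALGEBRAIC over `ℚ`; both
hypotheses matter (for three algebraically independent critical points no `κ`-coric function of
positive degree exists: the divisor of a `κ`-coric `f` is algebraic over `ℚ`, so `f = P/Q` with
`P, Q ∈ ℚ̄[t]` up to a scalar, and `f(e₁), f(e₂) ∈ μ_∞` forces `P = ζ Q`). We therefore discharge

* `CriticalLocus.existsKappaCoricDegreeFour_holds` : `[IsAlgClosed Ω]`, critical points algebraic
  over `ℚ` ⟹ `S.ExistsKappaCoricDegreeFour`;
* `CriticalLocus.everyValueAttained_holds` : same hypotheses ⟹ `S.EveryValueAttained Set.univ`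
  (the `L̄` reading; the `L^⊡` reading — solvably closed subfields, via the solvability of `S₄` —
  is not attempted here).

Construction (the "elementary theory of polynomial functions on the affine line"): with
`g := ∏_{e ∈ S} (t - e)`, a rational `a ∉ S` and a rational `λ ∉ {0} ∪ {λ | λ³ = 256·g(a)}`,
`f := ((t - a)⁴ + λ·g) / (t - a)⁴` has the single pole `a`, takes the value `1` at every strictly
critical point, has algebraic zeroes (its numerator has algebraic coefficients), at least two of
them distinct (if all four coincided, comparing the `t³`-coefficient and the value at `a` would give
`λ³ = 256·g(a)`), and for `v ≠ 1` the equation `f(t) = v`, i.e. `(1 - v)(t - a)⁴ + λ g(t) = 0`, has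
degree exactly `4`, hence a (necessarily non-critical) solution; `v = 1` is the value of the
constant `κ`-coric function `1`. Nothing here bears on the disputed parts of the series.
-/

namespace Literature.IUT.HodgeTheaters

open Polynomial
open scoped RatFunc Classical

universe u

variable {Ω : Type u} [Field Ω]

namespace CriticalLocus

/-! ### Tools -/

/-- Uniqueness of the normalised numerator/denominator: if `q` is monic and coprime to `p`, then
`p / q` has numerator `p` and denominator `q`. [folklore] -/
private theorem num_denom_div_of_isCoprime' {p q : Ω[X]} (hq : q.Monic) (hpq : IsCoprime p q) :
    (algebraMap Ω[X] (RatFunc Ω) p / algebraMap Ω[X] (RatFunc Ω) q).num = p ∧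
      (algebraMap Ω[X] (RatFunc Ω) p / algebraMap Ω[X] (RatFunc Ω) q).denom = q := by
  set x := algebraMap Ω[X] (RatFunc Ω) p / algebraMap Ω[X] (RatFunc Ω) q with hx
  have h : x.num * q = p * x.denom := (RatFunc.num_mul_eq_mul_denom_iff hq.ne_zero).mpr rfl
  have h1 : q ∣ x.denom := by
    refine (hpq.symm).dvd_of_dvd_mul_left ⟨x.num, ?_⟩
    rw [← h, mul_comm]
  have h2 : x.denom ∣ q := by
    refine (RatFunc.isCoprime_num_denom x).symm.dvd_of_dvd_mul_left ⟨p, ?_⟩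
    rw [h, mul_comm]
  have hd : x.denom = q :=
    (Polynomial.eq_of_monic_of_associated (RatFunc.monic_denom x) hq
      (associated_of_dvd_dvd h2 h1))
  refine ⟨?_, hd⟩
  rw [hd] at h
  exact mul_right_cancel₀ hq.ne_zero h

/-- A root of a nonzero polynomial whose coefficients are algebraic over `ℚ` (i.e. which lifts to
the subalgebra of `ℚ`-algebraic elements) is algebraic over `ℚ`. [folklore] -/
private theorem isAlgebraic_of_mem_lifts [CharZero Ω] {p : Ω[X]} (hp : p ≠ 0)
    (hl : p ∈ Polynomial.lifts (algebraMap (Subalgebra.algebraicClosure ℚ Ω) Ω)) {r : Ω}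
    (hr : p.eval r = 0) : IsAlgebraic ℚ r := by
  obtain ⟨q, hq⟩ := (Polynomial.mem_lifts _).mp hl
  have hq0 : q ≠ 0 := by
    rintro rfl; apply hp; rw [← hq, Polynomial.map_zero]
  have halg : IsAlgebraic (Subalgebra.algebraicClosure ℚ Ω) r :=
    ⟨q, hq0, by rw [← Polynomial.eval_map_algebraMap, hq, hr]⟩
  exact halg.restrictScalars ℚ

section Construction

variable (S : CriticalLocus Ω)

/-- The cubic `g = ∏_{e ∈ S} (t - e)`: monic of degree `3`, vanishing exactly on `S`. [folklore] -/
private theorem g_facts :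
    (∏ e ∈ S.pts, (X - C e)).Monic ∧ (∏ e ∈ S.pts, (X - C e)).natDegree = 3 ∧
      (∀ e ∈ S.pts, (∏ e ∈ S.pts, (X - C e)).eval e = 0) ∧
      (∀ a ∉ S.pts, (∏ e ∈ S.pts, (X - C e)).eval a ≠ 0) := by
  refine ⟨monic_prod_of_monic _ _ fun e _ => monic_X_sub_C e, ?_, fun e he => ?_, fun a ha => ?_⟩
  · rw [natDegree_prod_of_monic _ _ fun e _ => monic_X_sub_C e]
    simp [S.card_eq]
  · rw [eval_prod]
    exact Finset.prod_eq_zero he (by simp)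
  · rw [eval_prod, Finset.prod_ne_zero_iff]
    intro e he
    have : a ≠ e := fun h => ha (h ▸ he)
    simpa [sub_eq_zero] using this

/-- The numerator `P = (t - a)⁴ + λ g`: monic of degree `4`, `P(e) = (e - a)⁴` on `S`,
`P(a) = λ g(a)`, and `t³`-coefficient `nextCoeff P = λ - 4a`. [folklore] -/
private theorem P_facts (a l : Ω) :
    ((X - C a) ^ 4 + C l * ∏ e ∈ S.pts, (X - C e)).Monic ∧
      ((X - C a) ^ 4 + C l * ∏ e ∈ S.pts, (X - C e)).natDegree = 4 ∧
      (∀ e ∈ S.pts, ((X - C a) ^ 4 + C l * ∏ e ∈ S.pts, (X - C e)).eval e = (e - a) ^ 4) ∧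
      ((X - C a) ^ 4 + C l * ∏ e ∈ S.pts, (X - C e)).eval a =
        l * (∏ e ∈ S.pts, (X - C e)).eval a ∧
      ((X - C a) ^ 4 + C l * ∏ e ∈ S.pts, (X - C e)).nextCoeff = l - 4 * a := by
  obtain ⟨hgm, hgd, hge, -⟩ := g_facts S
  have hQm : ((X - C a) ^ 4 : Ω[X]).Monic := (monic_X_sub_C a).pow 4
  have hQd : ((X - C a) ^ 4 : Ω[X]).natDegree = 4 := by
    rw [(monic_X_sub_C a).natDegree_pow, natDegree_X_sub_C, mul_one]
  have hlt : (C l * ∏ e ∈ S.pts, (X - C e)).degree < ((X - C a) ^ 4 : Ω[X]).degree := by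
    apply degree_lt_degree
    calc (C l * ∏ e ∈ S.pts, (X - C e)).natDegree ≤ (∏ e ∈ S.pts, (X - C e)).natDegree :=
          natDegree_C_mul_le _ _
      _ < ((X - C a) ^ 4 : Ω[X]).natDegree := by rw [hgd, hQd]; norm_num
  have hPd : ((X - C a) ^ 4 + C l * ∏ e ∈ S.pts, (X - C e)).natDegree = 4 := by
    rw [natDegree_add_eq_left_of_degree_lt hlt, hQd]
  refine ⟨hQm.add_of_left hlt, hPd, fun e he => ?_, ?_, ?_⟩
  · rw [eval_add, eval_mul, hge e he, mul_zero, add_zero, eval_pow, eval_sub, eval_X, eval_C]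
  · rw [eval_add, eval_mul, eval_C, eval_pow, eval_sub, eval_X, eval_C, sub_self,
      zero_pow (by norm_num), zero_add]
  · -- the `t³`-coefficient
    rw [nextCoeff_of_natDegree_pos (by rw [hPd]; norm_num), hPd, coeff_add, coeff_C_mul]
    have h1 : ((X - C a) ^ 4 : Ω[X]).coeff (4 - 1) = -(4 * a) := by
      have := nextCoeff_of_natDegree_pos (p := ((X - C a) ^ 4 : Ω[X])) (by rw [hQd]; norm_num)
      rw [hQd] at this
      rw [← this, (monic_X_sub_C a).nextCoeff_pow, nextCoeff_X_sub_C, nsmul_eq_mul]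
      push_cast; ring
    have h2 : (∏ e ∈ S.pts, (X - C e)).coeff (4 - 1) = 1 := by
      have := hgm.coeff_natDegree; rwa [hgd] at this
    rw [h1, h2]; ring

/-- If `λ ≠ 0` and `λ³ ≠ 256·g(a)`, the numerator `P` has at least two distinct roots in the
algebraically closed field `Ω`. [folklore] -/
private theorem two_le_card_roots [IsAlgClosed Ω] [CharZero Ω] {a l : Ω} (hl : l ≠ 0)
    (hl3 : l ^ 3 ≠ 256 * (∏ e ∈ S.pts, (X - C e)).eval a) :
    2 ≤ ((X - C a) ^ 4 + C l * ∏ e ∈ S.pts, (X - C e)).roots.toFinset.card := by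
  obtain ⟨hPm, hPd, -, hPa, hPn⟩ := P_facts S a l
  set P := (X - C a) ^ 4 + C l * ∏ e ∈ S.pts, (X - C e) with hP
  have hsplit : P.Splits := IsAlgClosed.splits P
  have hcard : P.roots.card = 4 := by rw [← hsplit.natDegree_eq_card_roots, hPd]
  by_contra hlt
  have hle : P.roots.toFinset.card ≤ 1 := by omega
  -- all four roots coincide with some `b`
  obtain ⟨b, hb⟩ : ∃ b, b ∈ P.roots :=
    Multiset.card_pos_iff_exists_mem.mp (by rw [hcard]; norm_num)
  have hall : ∀ x ∈ P.roots, x = b := fun x hx =>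
    Finset.card_le_one.mp hle x (Multiset.mem_toFinset.mpr hx) b (Multiset.mem_toFinset.mpr hb)
  have hroots : P.roots = Multiset.replicate 4 b := Multiset.eq_replicate.mpr ⟨hcard, hall⟩
  -- `t³`-coefficient: `λ - 4a = -4b`
  have hnext : l - 4 * a = -(4 * b) := by
    rw [← hPn, hsplit.nextCoeff_eq_neg_sum_roots_of_monic hPm, hroots, Multiset.sum_replicate,
      nsmul_eq_mul]
    push_cast; ring
  -- value at `a`: `λ g(a) = (a - b)⁴`
  have heval : l * (∏ e ∈ S.pts, (X - C e)).eval a = (a - b) ^ 4 := by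
    rw [← hPa, hsplit.eval_eq_prod_roots_of_monic hPm, hroots, Multiset.map_replicate,
      Multiset.prod_replicate]
  have hb' : a - b = l / 4 := by linear_combination (-1 / 4 : Ω) * hnext
  rw [hb'] at heval
  -- hence `λ (256 g(a) - λ³) = 0`
  have key : l * (256 * (∏ e ∈ S.pts, (X - C e)).eval a - l ^ 3) = 0 := by
    linear_combination (256 : Ω) * heval
  rcases mul_eq_zero.mp key with h | h
  · exact hl h
  · exact hl3 (sub_eq_zero.mp h).symm

end Construction

/-! ### The main construction -/

section Main

variable [CharZero Ω] [IsAlgClosed Ω] (S : CriticalLocus Ω)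

/-- The `κ`-coric function of degree `4` of Rmk 3.1.7 (ii), with its two extra properties used
below: it takes the value `1` on `S`, and every value `v ≠ 1` at some non-critical point.
[claim: Mochizuki2012, status: disputed] -/
theorem exists_kappaCoric_degree_four_with_values (hS : ∀ e ∈ S.pts, IsAlgebraic ℚ e) :
    ∃ f : RatFunc Ω, S.IsKappaCoric f ∧ f.num.natDegree = 4 ∧
      ∀ v : Ω, v ≠ 1 → ∃ t : Ω, t ∉ S.pts ∧ f.denom.eval t ≠ 0 ∧ f.eval (RingHom.id Ω) t = v := by
  obtain ⟨hgm, hgd, hge, hga⟩ := g_facts S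
  set g : Ω[X] := ∏ e ∈ S.pts, (X - C e) with hg
  -- a rational non-critical point `a`
  obtain ⟨a, ⟨qa, hqa⟩, ha⟩ :=
    (Set.infinite_range_of_injective (algebraMap ℚ Ω).injective).exists_notMem_finset S.pts
  have ha_alg : IsAlgebraic ℚ a := hqa ▸ isAlgebraic_algebraMap qa
  -- a rational `λ ∉ {0} ∪ {λ | λ³ = 256 g(a)}`
  obtain ⟨l, ⟨ql, hql⟩, hl⟩ :=
    (Set.infinite_range_of_injective (algebraMap ℚ Ω).injective).exists_notMem_finset
      (insert 0 (nthRootsFinset 3 (256 * g.eval a)))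
  have hl_alg : IsAlgebraic ℚ l := hql ▸ isAlgebraic_algebraMap ql
  rw [Finset.mem_insert, not_or, mem_nthRootsFinset (by norm_num)] at hl
  obtain ⟨hl0, hl3⟩ := hl
  obtain ⟨hPm, hPd, hPe, hPa, -⟩ := P_facts S a l
  set P : Ω[X] := (X - C a) ^ 4 + C l * g with hP
  set Q : Ω[X] := (X - C a) ^ 4 with hQ
  have hQm : Q.Monic := (monic_X_sub_C a).pow 4
  have hQe : ∀ t, Q.eval t = (t - a) ^ 4 := fun t => by
    simp only [hQ, eval_pow, eval_sub, eval_X, eval_C]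
  have hPa0 : P.eval a ≠ 0 := by rw [hPa]; exact mul_ne_zero hl0 (hga a ha)
  -- `P` and `Q` are coprime: `a` is not a root of `P`
  have hcop : IsCoprime P Q := by
    have h1 : IsCoprime (X - C a) P := by
      rw [(irreducible_X_sub_C a).coprime_iff_not_dvd, dvd_iff_isRoot]
      exact hPa0
    exact h1.symm.pow_right
  set f : RatFunc Ω := algebraMap Ω[X] (RatFunc Ω) P / algebraMap Ω[X] (RatFunc Ω) Q with hf
  obtain ⟨hnum, hden⟩ : f.num = P ∧ f.denom = Q := num_denom_div_of_isCoprime' hQm hcop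
  -- the values of `f`
  have hfe : ∀ t, f.eval (RingHom.id Ω) t = P.eval t / (t - a) ^ 4 := fun t => by
    rw [RatFunc.eval, hnum, hden, eval₂_id, eval₂_id, hQe]
  -- `P` lifts to the subalgebra of algebraic elements
  have hPlifts : P ∈ Polynomial.lifts (algebraMap (Subalgebra.algebraicClosure ℚ Ω) Ω) := by
    set A := Subalgebra.algebraicClosure ℚ Ω
    rw [Polynomial.lifts_iff_liftsRing]
    set T := Polynomial.liftsRing (algebraMap A Ω)
    have hX : (X : Ω[X]) ∈ T :=
      (Polynomial.lifts_iff_liftsRing (algebraMap A Ω) X).mp (Polynomial.X_mem_lifts _)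
    have hC : ∀ x : Ω, IsAlgebraic ℚ x → C x ∈ T := fun x hx =>
      (Polynomial.lifts_iff_liftsRing (algebraMap A Ω) (C x)).mp
        (Polynomial.C_mem_lifts (algebraMap A Ω) ⟨x, hx⟩)
    refine T.add_mem (T.pow_mem (T.sub_mem hX (hC a ha_alg)) 4) (T.mul_mem (hC l hl_alg) ?_)
    exact prod_mem fun e he => T.sub_mem hX (hC e (hS e he))
  refine ⟨f, ⟨fun _ => ⟨?_, ?_⟩, fun z hz => ?_, ⟨fun e he => ?_, fun e he => ?_, ?_⟩,
    fun e he => ⟨1, Nat.one_pos, ?_⟩⟩, by rw [hnum, hPd], fun v hv => ?_⟩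
  · -- exactly one pole, `a`
    rw [poles, hden, hQ, roots_pow, roots_X_sub_C, Multiset.toFinset_nsmul _ _ (by norm_num),
      Multiset.toFinset_singleton, Finset.card_singleton]
  · -- at least two distinct zeroes
    rw [zeroes, hnum]
    exact two_le_card_roots S hl0 hl3
  · -- the divisor is algebraic
    rw [Finset.mem_union, zeroes, poles, hnum, hden, Multiset.mem_toFinset, Multiset.mem_toFinset,
      mem_roots hPm.ne_zero, hQ, roots_pow, roots_X_sub_C, Multiset.mem_nsmul] at hz
    rcases hz with hz | ⟨-, hz⟩
    · exact isAlgebraic_of_mem_lifts hPm.ne_zero hPlifts hz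
    · rw [Multiset.mem_singleton] at hz; exact hz ▸ ha_alg
  · -- no zero at a strictly critical point
    rw [hnum, hPe e he]
    exact pow_ne_zero _ (sub_ne_zero.mpr fun h => ha (h ▸ he))
  · -- no pole at a strictly critical point
    rw [hden, hQe]
    exact pow_ne_zero _ (sub_ne_zero.mpr fun h => ha (h ▸ he))
  · -- no zero or pole at the cusp
    rw [hnum, hden, hPd, hQ, (monic_X_sub_C a).natDegree_pow, natDegree_X_sub_C]
  · -- value `1` at every strictly critical point
    rw [pow_one, hfe, hPe e he]
    exact div_self (pow_ne_zero _ (sub_ne_zero.mpr fun h => ha (h ▸ he)))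
  · -- every value `v ≠ 1` is attained at a non-critical point
    have hdeg : (C (1 - v) * Q + C l * g).natDegree = 4 := by
      have hQd : (C (1 - v) * Q).natDegree = 4 := by
        rw [natDegree_C_mul (sub_ne_zero.mpr (Ne.symm hv)), hQ, (monic_X_sub_C a).natDegree_pow,
          natDegree_X_sub_C]
      have hlt : (C l * g).degree < (C (1 - v) * Q).degree := by
        apply degree_lt_degree
        calc (C l * g).natDegree ≤ g.natDegree := natDegree_C_mul_le _ _
          _ < (C (1 - v) * Q).natDegree := by rw [hgd, hQd]; norm_num
      rw [natDegree_add_eq_left_of_degree_lt hlt, hQd]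
    obtain ⟨t, ht⟩ := IsAlgClosed.exists_root (C (1 - v) * Q + C l * g)
      (by rw [degree_eq_natDegree (by rintro h; rw [h, natDegree_zero] at hdeg; exact absurd hdeg (by norm_num)), hdeg]; norm_num)
    rw [IsRoot, eval_add, eval_mul, eval_C, eval_mul, eval_C, hQe] at ht
    -- `t` is not critical and not the pole
    have hta : t ≠ a := by
      rintro rfl
      rw [sub_self, zero_pow (by norm_num), mul_zero, zero_add] at ht
      exact mul_ne_zero hl0 (hga _ ha) ht
    have htS : t ∉ S.pts := by
      intro htS
      rw [hge t htS, mul_zero, add_zero] at ht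
      exact mul_ne_zero (sub_ne_zero.mpr (Ne.symm hv)) (pow_ne_zero _ (sub_ne_zero.mpr hta)) ht
    refine ⟨t, htS, ?_, ?_⟩
    · rw [hden, hQe]; exact pow_ne_zero _ (sub_ne_zero.mpr hta)
    · rw [hfe, div_eq_iff (pow_ne_zero _ (sub_ne_zero.mpr hta)), hP, eval_add, eval_mul, eval_C,
        hQe]
      linear_combination ht
end Main

/-! ### The two printed existence claims -/

section Claims

variable [CharZero Ω] [IsAlgClosed Ω] (S : CriticalLocus Ω)

/-- **Rmk 3.1.7 (ii), p. 67, DISCHARGED** (for `Ω = L̄` algebraically closed and strictly critical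
points algebraic over `ℚ`, as in print): "there exists a `κ`-coric `f_sol ∈ L_C` of degree `4`".
[claim: Mochizuki2012, status: disputed] -/
theorem existsKappaCoricDegreeFour_holds (hS : ∀ e ∈ S.pts, IsAlgebraic ℚ e) :
    S.ExistsKappaCoricDegreeFour := by
  obtain ⟨f, hf, hdeg, -⟩ := exists_kappaCoric_degree_four_with_values S hS
  exact ⟨f, hf, hdeg⟩

/-- **Rmk 3.1.7 (ii), p. 67, DISCHARGED** (the `L̄`-reading, `M = Ω = L̄` algebraically closed,
strictly critical points algebraic over `ℚ`): "every element of `L̄` appears as a value of some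
`κ`-coric rational function on `C_L` at some `L̄`-valued point of `C_L` that is not critical".
[claim: Mochizuki2012, status: disputed] -/
theorem everyValueAttained_holds (hS : ∀ e ∈ S.pts, IsAlgebraic ℚ e) :
    S.EveryValueAttained Set.univ := by
  intro v _
  by_cases hv : v = 1
  · -- the constant function `1` is `κ`-coric; evaluate it at any non-critical point
    subst hv
    obtain ⟨t, ht⟩ := Infinite.exists_notMem_finset S.pts
    have h1 : S.IsKappaCoric (1 : RatFunc Ω) := by
      refine ⟨fun h => absurd (map_one RatFunc.C).symm (h 1), fun z hz => ?_,
        ⟨fun e _ => ?_, fun e _ => ?_, ?_⟩, fun e _ => ⟨1, Nat.one_pos, ?_⟩⟩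
      · simp [zeroes, poles] at hz
      · simp
      · simp
      · simp
      · simp
    exact ⟨1, h1, t, Set.mem_univ t, ht, by simp, by simp⟩
  · obtain ⟨f, hf, -, hval⟩ := exists_kappaCoric_degree_four_with_values S hS
    obtain ⟨t, htS, htd, htv⟩ := hval v hv
    exact ⟨f, hf, t, Set.mem_univ t, htS, htd, htv⟩

end Claims

end CriticalLocus

end Literature.IUT.HodgeTheaters
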